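import Literature.Algebra.Polynomial.CasasAlvero.Induction
import Literature.Algebra.Polynomial.CasasAlvero.Descent
import HarnessLib

/-!
# Casas-Alvero over arbitrary fields of characteristic `p`: corollaries of `Induction` + `Descent`

Combining GvBLSW Prop. 6 in full (`holdsInDegree_mul_prime_pow`, file `Induction.lean`, perfect rings of
characteristic `p`) with descent along the embedding of a field into its algebraic closure
(`HoldsInDegree.descend`, file `Descent.lean`):

* `holdsInDegree_mul_prime_pow_field` — for a field `K` of characteristic `p`: if the Casas-Alvero statement holds in
  degree `n` over the algebraic closure of `K`, then it holds in degree `n · p^k` over `K` itself.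
* `holdsInDegree_three_mul_prime_pow_field` — over every field of characteristic `p ≥ 5`, a monic Casas-Alvero
  polynomial of degree `3 · p^k` is `(X - a)^(3 p^k)`.

Reference: H.-C. Graf von Bothmer, O. Labs, J. Schicho, C. van de Woestijne, *The Casas-Alvero conjecture for
infinitely many degrees*, J. Algebra 316 (2007) 224–230, arXiv:math/0605090, Props. 3, 6.
-/

noncomputable section

open Polynomial

namespace Literature.Algebra.Polynomial.CasasAlvero

variable (K : Type*) [Field K] (p : ℕ) [Fact p.Prime] [CharP K p]

/-- GvBLSW Prop. 6 descended to an arbitrary field `K` of characteristic `p`: Casas-Alvero in degree `n` over the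
algebraic closure of `K` implies Casas-Alvero in degree `n · p^k` over `K`. [cite: GrafVonBothmerEtAl2007, Prop. 6] -/
theorem holdsInDegree_mul_prime_pow_field {n : ℕ} (hn : HoldsInDegree (AlgebraicClosure K) n) (k : ℕ) :
    HoldsInDegree K (n * p ^ k) :=
  HoldsInDegree.descend (algebraMap K (AlgebraicClosure K)) (holdsInDegree_mul_prime_pow p hn k)

/-- Over every field of characteristic `p ≥ 5`, a monic Casas-Alvero polynomial of degree `3 · p^k` is
`(X - a)^(3 p^k)` (degree `3` is elementary away from characteristics `2, 3`; then GvBLSW Prop. 6 and descent).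
[cite: GrafVonBothmerEtAl2007, Prop. 6] -/
theorem holdsInDegree_three_mul_prime_pow_field (hp5 : 5 ≤ p) (k : ℕ) : HoldsInDegree K (3 * p ^ k) :=
  HoldsInDegree.descend (algebraMap K (AlgebraicClosure K)) (holdsInDegree_three_mul_prime_pow p hp5 k)

end Literature.Algebra.Polynomial.CasasAlvero
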